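import Summits.CriticalPhenomena.PercolationContinuityZ3.Theorems.PercNearOneGluingNoHeavyLowerTailClubPsiJoint
import HarnessLib

/-!
# `NoHeavyLowerTail` (stmt-CriticalPhenomena-4575) — CLUB-Ψ(x), step 1: the two conditionings (from the JOINT atom)

Support file (prover `prim-cplus-coupling`, gen 16; `--supports stmt-CriticalPhenomena-4575`); no definitions, named facts
or sorries.  Cell memo A5-COUPLING-gen16.md; companion `…ClubPsiJoint.lean` (the JOINT atom = `P1**-PLAIN-set` + BHK).

Notation (one bond percolation `μ`, observer SET `N`, designated port `x`, port `y`, witness `z`; `v ↔ N := ∃ n ∈ N, v ↔ n`,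
`C_N = ⋃_{n∈N} C_n`): `J' = ({x↔N} ∪ {y↔N}) ∩ {z↮N}`, `E = {x↮N} ∩ {y↮N} ∩ {z↮N}`, `W2 = {y↔N} ∩ {x↮N} ∩ {z↮N}`,
`E2 = {y↮x} ∩ {y↮z}`, `Dzx = {z↮x}`, `Dyx = {y↮x}`, `Mz = {z↔N} ∩ {z↮x}`, `Jyz = {z↔y} ∩ {z↮x}`;
`b = μ(W2)`, `e₂ = μ(E2)`, `d = μ(Dzx)`, `c = μ(Mz)`, `j = μ(Jyz)`;  `K_x(F) = ∫_{J'}[F(C_N) − F(C_z)] + ∫_E[F(C_x) − F(C_z)]`.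
* `ClubPsi.club_L_nonneg` — from `ClubPsi.joint_nonneg` at `G = F` and `G = −k_F` (`k_F(S) = E F(C_x(η ∖ S̄))`, ONE antitone
  function of the conditioning cluster, be it `C_y` or `C_z`) and the tower / Harris-off-the-cluster steps
  (`Q7Psi.setIntegral_cluster_tower`, `Q7Psi.setIntegral_offEvent_le`):
  `e₂ d [∫_{W2}(F(C_y) − F(C_x)) + ∫_{Mz}(F(C_z) − F(C_x))] ≥ b d (E F(C_y) − E F(C_x)) + (e₂ c − b j)(E F(C_z) − E F(C_x))`.
* `ClubPsi.club_certificate` — `(e₂ d − b d − e₂ c + b j) · Dx(F) + b d · Dy(F) ≤ e₂ d · K_x(F)` for every monotone `F ≥ 0`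
  (pointwise `K_x − Dx ≥ ∫_{W2}(F(C_y) − F(C_x)) + ∫_{Mz}(F(C_z) − F(C_x))`, then `club_L_nonneg`).
* `ClubPsi.club_kappa_nonneg` — `0 ≤ (e₂ d − b d − e₂ c + b j) · μ(x ↮ y, x ↮ z)` (`club_L_nonneg` at `F = 1{y ∈ ·} ∨ 1{z ∈ ·}`).
* `ClubPsi.clubPsi` — **CLUB-Ψ(x)** (prim-lf-3 LF3-BETA-R §18g "MRΨ-glued", the last residual of the 2+m kernel; coupling seat
  gen15 §2 "CLUBΨ-x"): if `μ(x↮y, x↮z), μ(E2), μ(Dzx) > 0` (e.g. all weights `< 1`) then `Dx(F) ≥ 0 ∧ Dy(F) ≥ 0 ⟹ K_x(F) ≥ 0`,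
  i.e. `E F(C̃_z) ≤ ∫_{N↔{x,y,z}} F(C_N) + ∫_{N↮{x,y,z}} F(C_x)` in `G/N`.  `N = {o}`: the max-robust (GΨ₃) (`Q7Psi.gpsi_three_maxrobust`).
[cite: KozmaNitzan2024, §5.1 (pp. 31–32), Questions 7–9 (p. 36)] [cite: VandenbergHaggstromKahn2005, Thm 1.3 (p. 6), §1 pp. 7–8]
-/

namespace Summit.CriticalPhenomena.PercolationContinuityZ3.Theorems

open MeasureTheory Set Literature.Probability.LatticeModels Literature.Probability.Percolation
open scoped Classical
open KNPreFKG BHK2006 DecisionTree LonePortSum LonePortSumGeneral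

noncomputable section

namespace ClubPsi

open Q7Psi

universe u

variable {V : Type u} [Fintype V]

/-- **The two conditionings.**  For monotone `F ≥ 0` on vertex sets (notation of the file header):
`b d (E F(C_y) − E F(C_x)) + (e₂ c − b j)(E F(C_z) − E F(C_x)) ≤ e₂ d [∫_{W2} F(C_y) − ∫_{W2} F(C_x) + ∫_{Mz} F(C_z) − ∫_{Mz} F(C_x)]`.
Proof: `joint_nonneg` at `G = F` and at the antitone conditional mean `G = −k_F`; `∫_{W2} F(C_x) ≤ ∫_{W2} k_F(C_y)` (Harris off `C_y`:
`{x↮N} ∩ {z↮N}` is decreasing and read off `C̄_y`), `∫_{y↮x} F(C_x) = ∫_{y↮x} k_F(C_y)`, `∫_{Mz} F(C_x) = ∫_{Mz} k_F(C_z)`,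
`∫_{z↮x} F(C_x) = ∫_{z↮x} k_F(C_z)` (tower), and `C_y = C_x` off `{y↮x}`, `C_z = C_x` off `{z↮x}`. (cell memo A5-COUPLING-gen16 §2)
[cite: VandenbergHaggstromKahn2005, §1 pp. 7–8 (display (10), Harris)] [cite: KozmaNitzan2024, Question 9 (p. 36)] -/
theorem club_L_nonneg (w : Sym2 V → unitInterval) (x y z : V) (N : Set V) (hyx : y ≠ x) (hyz : y ≠ z)
    (F : Set V → ℝ) (hF : ∀ S T : Set V, S ⊆ T → F S ≤ F T) (hF0 : ∀ S, 0 ≤ F S) :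
    (prodBernoulli w).real ({ω : BondConfig V | ∃ n ∈ N, (openGraph ω).Reachable y n} ∩
          ({ω | ∀ n ∈ N, ¬ (openGraph ω).Reachable x n} ∩ {ω | ∀ n ∈ N, ¬ (openGraph ω).Reachable z n})) *
        (prodBernoulli w).real {ω : BondConfig V | ¬ (openGraph ω).Reachable z x} *
        ((∫ ω, F (openCluster ω y) ∂(prodBernoulli w)) - ∫ ω, F (openCluster ω x) ∂(prodBernoulli w)) +
      ((prodBernoulli w).real ({ω : BondConfig V | ¬ (openGraph ω).Reachable y x} ∩ {ω | ¬ (openGraph ω).Reachable y z}) *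
          (prodBernoulli w).real ({ω : BondConfig V | ∃ n ∈ N, (openGraph ω).Reachable z n} ∩
            {ω | ¬ (openGraph ω).Reachable z x}) -
        (prodBernoulli w).real ({ω : BondConfig V | ∃ n ∈ N, (openGraph ω).Reachable y n} ∩
            ({ω | ∀ n ∈ N, ¬ (openGraph ω).Reachable x n} ∩ {ω | ∀ n ∈ N, ¬ (openGraph ω).Reachable z n})) *
          (prodBernoulli w).real (openConn z y ∩ {ω | ¬ (openGraph ω).Reachable z x})) *
        ((∫ ω, F (openCluster ω z) ∂(prodBernoulli w)) - ∫ ω, F (openCluster ω x) ∂(prodBernoulli w)) ≤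
    (prodBernoulli w).real ({ω : BondConfig V | ¬ (openGraph ω).Reachable y x} ∩ {ω | ¬ (openGraph ω).Reachable y z}) *
      (prodBernoulli w).real {ω : BondConfig V | ¬ (openGraph ω).Reachable z x} *
      ((∫ ω in {ω : BondConfig V | ∃ n ∈ N, (openGraph ω).Reachable y n} ∩
            ({ω | ∀ n ∈ N, ¬ (openGraph ω).Reachable x n} ∩ {ω | ∀ n ∈ N, ¬ (openGraph ω).Reachable z n}),
            F (openCluster ω y) ∂(prodBernoulli w)) -
        (∫ ω in {ω : BondConfig V | ∃ n ∈ N, (openGraph ω).Reachable y n} ∩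
            ({ω | ∀ n ∈ N, ¬ (openGraph ω).Reachable x n} ∩ {ω | ∀ n ∈ N, ¬ (openGraph ω).Reachable z n}),
            F (openCluster ω x) ∂(prodBernoulli w)) +
        (∫ ω in {ω : BondConfig V | ∃ n ∈ N, (openGraph ω).Reachable z n} ∩ {ω | ¬ (openGraph ω).Reachable z x},
            F (openCluster ω z) ∂(prodBernoulli w)) -
        ∫ ω in {ω : BondConfig V | ∃ n ∈ N, (openGraph ω).Reachable z n} ∩ {ω | ¬ (openGraph ω).Reachable z x},
            F (openCluster ω x) ∂(prodBernoulli w)) := by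
  classical
  set μ := prodBernoulli w with hμ
  set wt : Set (Sym2 V) → ℝ := weight (fun e => (w e : ℝ)) with hwt
  set fx : BondConfig V → ℝ := fun ω => F (openCluster ω x) with hfx
  set fy : BondConfig V → ℝ := fun ω => F (openCluster ω y) with hfy
  set fz : BondConfig V → ℝ := fun ω => F (openCluster ω z) with hfz
  set Oy : Set (BondConfig V) := {ω : BondConfig V | ∃ n ∈ N, (openGraph ω).Reachable y n} with hOy
  set Oz : Set (BondConfig V) := {ω : BondConfig V | ∃ n ∈ N, (openGraph ω).Reachable z n} with hOz
  set Ex : Set (BondConfig V) := {ω | ∀ n ∈ N, ¬ (openGraph ω).Reachable x n} with hEx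
  set Ez : Set (BondConfig V) := {ω | ∀ n ∈ N, ¬ (openGraph ω).Reachable z n} with hEz
  set W2 : Set (BondConfig V) := Oy ∩ (Ex ∩ Ez) with hW2
  set Dyx : Set (BondConfig V) := {ω : BondConfig V | ¬ (openGraph ω).Reachable y x} with hDyx
  set Dyz : Set (BondConfig V) := {ω : BondConfig V | ¬ (openGraph ω).Reachable y z} with hDyz
  set Dzx : Set (BondConfig V) := {ω : BondConfig V | ¬ (openGraph ω).Reachable z x} with hDzx
  set E2 : Set (BondConfig V) := Dyx ∩ Dyz with hE2
  set Mz : Set (BondConfig V) := Oz ∩ Dzx with hMz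
  set Jyz : Set (BondConfig V) := openConn z y ∩ Dzx with hJyz
  show μ.real W2 * μ.real Dzx * ((∫ ω, fy ω ∂μ) - ∫ ω, fx ω ∂μ) +
      (μ.real E2 * μ.real Mz - μ.real W2 * μ.real Jyz) * ((∫ ω, fz ω ∂μ) - ∫ ω, fx ω ∂μ) ≤
    μ.real E2 * μ.real Dzx * ((∫ ω in W2, fy ω ∂μ) - (∫ ω in W2, fx ω ∂μ) + (∫ ω in Mz, fz ω ∂μ) - ∫ ω in Mz, fx ω ∂μ)
  -- the conditional mean of `F(C_x)` given a cluster `S` (of `y` or of `z`), as a function of the vertex set `S`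
  set kV : Set V → ℝ := fun S => ∫ η, F (openCluster (η \ {e | ∃ v ∈ e, v ∈ S}) x) ∂μ with hkV
  have hkV_anti : ∀ S T : Set V, S ⊆ T → kV T ≤ kV S := by
    intro S T hST
    refine integral_mono (Integrable.of_finite) (Integrable.of_finite) fun η => hF _ _ (openCluster_mono ?_ x)
    exact Set.sdiff_subset_sdiff_right fun e ⟨v, hv, hvS⟩ => ⟨v, hv, hST hvS⟩
  -- the four events as `{P(C_owner)} ∩ E`
  set P2 : Set V → Prop := fun S => (∃ n ∈ N, n ∈ S) ∧ x ∉ S ∧ z ∉ S with hP2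
  set Py0 : Set V → Prop := fun S => x ∉ S with hPy0
  set Pm : Set V → Prop := fun S => (∃ n ∈ N, n ∈ S) ∧ x ∉ S with hPm
  have hW2P : W2 = {ω : BondConfig V | P2 (openCluster ω y)} ∩ (Ex ∩ Ez) := by
    ext ω
    simp only [hW2, hOy, hEx, hEz, hP2, mem_inter_iff, mem_setOf_eq, openCluster]
    constructor
    · rintro ⟨⟨n, hn, hyn⟩, hx', hz'⟩
      exact ⟨⟨⟨n, hn, hyn⟩, fun hyx' => hx' n hn (hyx'.symm.trans hyn), fun hyz' => hz' n hn (hyz'.symm.trans hyn)⟩, hx', hz'⟩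
    · rintro ⟨⟨hn, _, _⟩, hx', hz'⟩
      exact ⟨hn, hx', hz'⟩
  have hDyxP : Dyx = {ω : BondConfig V | Py0 (openCluster ω y)} := by
    ext ω; simp only [hDyx, hPy0, mem_setOf_eq, openCluster]
  have hMzP : Mz = {ω : BondConfig V | Pm (openCluster ω z)} := by
    ext ω
    simp only [hMz, hOz, hDzx, hPm, mem_inter_iff, mem_setOf_eq, openCluster]
  have hDzxP : Dzx = {ω : BondConfig V | Py0 (openCluster ω z)} := by
    ext ω; simp only [hDzx, hPy0, mem_setOf_eq, openCluster]
  -- (T1) Harris off `C_y` on `W2`; (T2)–(T4) tower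
  have hT1 := setIntegral_offEvent_le w y x F hF hF0 P2 (fun ω hP => hP.2.1) (Ex ∩ Ez)
    ((isLowerSet_notReachSet x N).inter (isLowerSet_notReachSet z N))
    (fun ω hP => by
      rw [mem_inter_iff, mem_inter_iff, notReachSet_sdiff_bar_iff N hP.2.1, notReachSet_sdiff_bar_iff N hP.2.2])
  have hT2 := setIntegral_cluster_tower w y x F Py0 (fun ω hP => hP)
  have hT3 := setIntegral_cluster_tower w z x F Pm (fun ω hP => hP.2)
  have hT4 := setIntegral_cluster_tower w z x F Py0 (fun ω hP => hP)
  rw [← hW2P] at hT1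
  rw [← hDyxP] at hT2
  rw [← hMzP] at hT3
  rw [← hDzxP] at hT4
  change ∫ ω in W2, fx ω ∂μ ≤ ∫ ω in W2, kV (openCluster ω y) ∂μ at hT1
  change ∫ ω in Dyx, fx ω ∂μ = ∫ ω in Dyx, kV (openCluster ω y) ∂μ at hT2
  change ∫ ω in Mz, fx ω ∂μ = ∫ ω in Mz, kV (openCluster ω z) ∂μ at hT3
  change ∫ ω in Dzx, fx ω ∂μ = ∫ ω in Dzx, kV (openCluster ω z) ∂μ at hT4
  -- JOINT at `G = F` and at `G = −kV`
  have hJ1 := joint_nonneg w x y z N hyx hyz F hF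
  have hJ2 := joint_nonneg w x y z N hyx hyz (fun S => -kV S) (fun S T hST => neg_le_neg (hkV_anti S T hST))
  simp only [integral_neg, mul_neg] at hJ2
  change 0 ≤ μ.real E2 * μ.real Dzx * (∫ ω in W2, fy ω ∂μ) - μ.real W2 * μ.real Dzx * (∫ ω in Dyx, fy ω ∂μ) +
      μ.real E2 * μ.real Dzx * (∫ ω in Mz, fz ω ∂μ) -
      (μ.real E2 * μ.real Mz - μ.real W2 * μ.real Jyz) * (∫ ω in Dzx, fz ω ∂μ) at hJ1
  change 0 ≤ -(μ.real E2 * μ.real Dzx * ∫ ω in W2, kV (openCluster ω y) ∂μ) -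
      -(μ.real W2 * μ.real Dzx * ∫ ω in Dyx, kV (openCluster ω y) ∂μ) +
      -(μ.real E2 * μ.real Dzx * ∫ ω in Mz, kV (openCluster ω z) ∂μ) -
      -((μ.real E2 * μ.real Mz - μ.real W2 * μ.real Jyz) * ∫ ω in Dzx, kV (openCluster ω z) ∂μ) at hJ2
  -- off `{y↮x}` (resp. `{z↮x}`) the clusters coincide
  have hwt0 : ∀ ω, 0 ≤ wt ω := fun ω => weight_nonneg (fun e => (w e).2.1) (fun e => (w e).2.2) ω
  have pDy : ∀ ω, wt ω * fy ω - wt ω * (fy ω * ind Dyx ω) = wt ω * fx ω - wt ω * (fx ω * ind Dyx ω) := by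
    intro ω
    by_cases h : ω ∈ Dyx
    · rw [ind_of_mem h, mul_one, mul_one, sub_self, sub_self]
    · have hyxr : (openGraph ω).Reachable y x := not_not.1 h
      rw [ind_of_not_mem h]
      simp only [mul_zero, sub_zero, hfy, hfx, openCluster_eq_of_reachable hyxr]
  have pDz : ∀ ω, wt ω * fz ω - wt ω * (fz ω * ind Dzx ω) = wt ω * fx ω - wt ω * (fx ω * ind Dzx ω) := by
    intro ω
    by_cases h : ω ∈ Dzx
    · rw [ind_of_mem h, mul_one, mul_one, sub_self, sub_self]
    · have hzxr : (openGraph ω).Reachable z x := not_not.1 h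
      rw [ind_of_not_mem h]
      simp only [mul_zero, sub_zero, hfz, hfx, openCluster_eq_of_reachable hzxr]
  have sDy : (∫ ω, fy ω ∂μ) - (∫ ω in Dyx, fy ω ∂μ) = (∫ ω, fx ω ∂μ) - ∫ ω in Dyx, fx ω ∂μ := by
    rw [integral_prodBernoulli_eq_sum, integral_prodBernoulli_eq_sum, setIntegral_eq_sum w, setIntegral_eq_sum w,
      ← Finset.sum_sub_distrib, ← Finset.sum_sub_distrib]
    exact Finset.sum_congr rfl fun ω _ => pDy ω
  have sDz : (∫ ω, fz ω ∂μ) - (∫ ω in Dzx, fz ω ∂μ) = (∫ ω, fx ω ∂μ) - ∫ ω in Dzx, fx ω ∂μ := by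
    rw [integral_prodBernoulli_eq_sum, integral_prodBernoulli_eq_sum, setIntegral_eq_sum w, setIntegral_eq_sum w,
      ← Finset.sum_sub_distrib, ← Finset.sum_sub_distrib]
    exact Finset.sum_congr rfl fun ω _ => pDz ω
  have hc0 : 0 ≤ μ.real E2 * μ.real Dzx := mul_nonneg measureReal_nonneg measureReal_nonneg
  have e1 := mul_le_mul_of_nonneg_left hT1 hc0
  rw [← hT2, ← hT4] at hJ2
  rw [hT3]
  have sDy' := congrArg (fun t => μ.real W2 * μ.real Dzx * t) sDy
  have sDz' := congrArg (fun t => (μ.real E2 * μ.real Mz - μ.real W2 * μ.real Jyz) * t) sDz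
  rw [mul_sub, mul_sub] at sDy' sDz'
  linarith [hJ1, hJ2, e1, sDy', sDz']

end ClubPsi

end

end Summit.CriticalPhenomena.PercolationContinuityZ3.Theorems
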